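import Summits.Schanuel.Schanuel.Theses.SheetDescent

/-!
# Birth skeleton (BC3) for crux `MovingDescent` — route `SheetDescent`
# "split the frozen lattice; bound above by specialisation over the frozen field; bound below by Ax on germs"

Skeleton registrar `planner-skel-stmt-Schanuel-13676-0`, 2026-08-17 (route re-audit bin REPAIRABLE).

TARGET (FIXED, concluded BY NAME): the route decl
`Summit.Schanuel.Schanuel.Theses.SheetDescent.MovingDescent` (item stmt-Schanuel-13676, crux, rank 4,
route file rev 2; grounded g25-11 "new as a statement, mechanism known and in tree (Ax 1971 Thm 3 =
`Literature.NumberTheory.Transcendental.ax_schanuel`, proved as `ax_schanuel_holds`)"; refuter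
crux-attack 2026-08-15: SURVIVES, zero-margin chain re-derived twice, triviality battery fails).

THE CRUX. Schanuel in every rank `r < n` ⇒ a ℚ-linearly independent `x ∈ ℂⁿ` with
`trdeg_ℚ ℚ(x, eˣ) < n` admits NO MOVING sheet deformation inside its ℚ-locus: no real-algebraic sheet
path `a : (0, ε) → ℝⁿ` and analytic witness path `ξ : (0, ε) → ℂⁿ`, continuous at `0⁺` with
`(a, ξ)(0) = (0, x)`, with `P(s) = (ξ(s) + 2πi a(s), e^{ξ(s)})` in the ℚ-locus of `P₀ = (x, eˣ)`,
non-trivial, and MOVING (every ℤ-combination `q·ξ` constant on `(0, ε)` has `q·a` constant there).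

## The cut (three named stubs; the crux's hypotheses are PARTITIONED among them)

Write `Λ = {q ∈ ℤⁿ : q·ξ constant on (0, ε)}` (the frozen lattice; saturated), `m = rk Λ`,
`r = n − m`.

* `stub_frozenMovingSplit` (A, size M; consumes `ε > 0`, `a 0 = 0`, `ξ 0 = x`, one-sided continuity,
  MOVING, NON-TRIVIALITY, analyticity of `ξ`): there are integer matrices `Uu` (`m` rows: a basis of
  `Λ`, ℚ-linearly independent) and `Uv` (`r` rows: a basis of a complement of the saturated `Λ`),
  `m + r = n`, `1 ≤ r`, such that along `(0, ε)` every frozen row is frozen AT ITS INITIAL VALUE and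
  its sheet combination vanishes (`Uu ξ ≡ Uu x`, `Uu a ≡ 0`: constancy + continuity at `0⁺` +
  `ξ 0 = x`; moving + continuity + `a 0 = 0`), while the moving block `v = Uv ξ` is analytic and
  ℚ-linearly independent modulo constants. `r = 0` is excluded by non-triviality (all of `ξ` frozen ⇒
  `ξ ≡ x`, `a ≡ 0`; the refuter's kernel-checked `frozen_deformation_absurd` / `frozen_combination`,
  evidence Helpers.lean v2 on the item, are exactly the `r = 0` step and the frozen-row identity).
* `stub_specialisationUpperBound` (B, size L; consumes Schanuel below `n`, `x` independent,
  `trdeg < n`, analyticity of `a, ξ`, the SHEET clause, the LOCUS clause, and A's frozen identities):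
  for ANY integer `Uv` and `v = Uv ξ`, every `r + 1` of the `2r` germs `v_j, e^{v_j}` satisfy a
  non-zero polynomial relation over ℂ identically on `(0, ε)` — i.e. `trdeg_ℂ ℂ(v, e^v) ≤ r`. Chain
  (margin zero): in `L = Frac(real-analytic germs on (0, ε))` (a domain: identity principle), the locus
  clause makes `ℚ[P]` a quotient of `ℚ[P₀]`, so `trdeg_ℚ ℚ(P) ≤ d := trdeg_ℚ ℚ(x, eˣ) ≤ n − 1`; the
  frozen identities put `F₀ = ℚ(Uu x, e^{Uu x})` inside `ℚ(P)` with `Uu x` ℚ-independent of size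
  `m < n`, so Schanuel in rank `m` and the tower law (`Algebra.trdeg_add_eq`) give
  `trdeg_{F₀} ℚ(P) ≤ d − m ≤ r − 1`, hence `trdeg_ℂ ℂ(P) ≤ r − 1`; each `a_i` is algebraic over `ℂ(s)`
  (its non-zero real relation `p_i(s, a_i) = 0` has positive `A`-degree since `s` is transcendental),
  so `trdeg_ℂ ℂ(P, s, a) ≤ r`, and `v = Uv(ξ + 2πi a) − 2πi Uv a`, `e^{v} = (e^{ξ})^{Uv}` lie in that
  field.
* `stub_axSchanuelGerms` (C, size L; consumes nothing from the crux — it is Ax 1971 Thm 3 for one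
  derivation on real-analytic germs): `r ≥ 1` analytic germs `v` on `(0, ε)`, ℚ-linearly independent
  modulo constants ⇒ some `r + 1` of the germs `v_j, e^{v_j}` are algebraically independent over ℂ on
  `(0, ε)` — i.e. `trdeg_ℂ ℂ(v, e^v) ≥ r + rank(∂v) = r + 1`, a transcendence basis being extractable
  from the generators. From the tree's `ax_schanuel_holds` with `K = Frac(germs)` (or Taylor transport
  into `LaurentSeries ℂ`, cf. the KZ-periods line `AxSchanuelGerms` / `stub_taylorMorphism`),
  `D = d/ds`, constants `= ℂ` on the connected interval.

COMPOSITION `MovingDescent_of` (kernel-checked, no `sorry` of its own, 8 lines of logic): destructure the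
deformation; A gives `(m, r, Uu, Uv, v)`; C (fed `r ≥ 1`, analyticity and independence of `v` from A)
gives an algebraically independent `(r+1)`-subfamily `φ`; B (fed the first-counterexample data, the
sheet and locus clauses and A's frozen identities) gives a non-zero relation on that very subfamily —
contradiction. Upper bound `r` against lower bound `r + 1`: the route's "margin exactly zero".

LOGICAL POSITION. stubs A ∧ B ∧ C ⟹ crux (`MovingDescent_of`). A and C have satisfiable hypotheses and
are theorems of mathematics (A: saturation + Smith normal form over ℤ + one-sided limits; C: Ax); B is
the specialisation inequality under the first-counterexample hypotheses. No stub alone is the crux or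
the summit: A knows nothing about transcendence, B nothing about continuity/moving/non-triviality and
proves only an UPPER bound, C is pure functional transcendence (BC3 probes, `Lines/birth.md`: 30/30
FAIL — `exact?` "could not close the goal", `simpa` type mismatch, `aesop` exhaustive-search failure or
heartbeat timeout, for each stub against `MovingDescent` and against `Schanuel`).

Disproof used: none exists for this crux (`ledger crux ls stmt-Schanuel-13676`: no workfiles before
this one). Negatives index (`ledger negatives --problem Schanuel`, 2 entries, both PolarPhantoms:
`¬ ∀ n y α, LinearIndependent ℚ y → (∀ j, α j ≠ 0) → trdeg ℚ(y, α) < n`): unrelated shape; no stub is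
an instance. Barrier `Literature.Barriers.Schanuel.AxSchanuelFunctionalNotNumerical`: honoured by
construction — Ax enters only stub C, on a genuine one-parameter analytic family; the only numerical
input (Schanuel below `n`) enters only stub B.
-/

noncomputable section

-- D-0017: the doubled `Schanuel.Schanuel` path component trips dupNamespace
set_option linter.dupNamespace false

namespace Summit.Schanuel.Schanuel.Cruxes.MovingDescent.Birth

open scoped BigOperators
open Summit.Schanuel.Schanuel.Theses.SheetDescent (MovingDescent)

/-! ## Registered stubs (each stated over Mathlib only; no vocabulary of this file is used) -/

/-- **STUB A — frozen/moving split of a moving deformation** (size M; lattice saturation + Smith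
normal form over `ℤ` + one-sided limits at `0⁺`). For a deformation `(a, ξ)` on `(0, ε)` with
`a 0 = 0`, `ξ 0 = x`, both continuous at `0` within `[0, ∞)`, `ξ` analytic, NON-TRIVIAL and MOVING:
there are `m + r = n`, `1 ≤ r`, an integer `m × n` matrix `Uu` with ℚ-linearly independent rows and an
integer `r × n` matrix `Uv` such that on `(0, ε)`: `Uu ξ ≡ Uu x` and `Uu a ≡ 0` (frozen rows are frozen
at their initial values and carry no sheet motion), and `v := Uv ξ` is analytic and ℚ-linearly
independent modulo constants (no non-zero integer combination of the `v_j` is constant on `(0, ε)`).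
Proof plan: `Λ = {q : q·ξ constant on (0,ε)}` is a saturated subgroup of `ℤⁿ`, hence a direct
summand (`Submodule.basisOfPid` / `Submodule.smithNormalForm`, torsion-free quotient ⇒ free ⇒ split);
`Uu` = a basis of `Λ` (`m = rk Λ` rows), `Uv` = a basis of a complement (`r = n − m` rows); for
`q ∈ Λ`, `q·ξ ≡ c` and `ContinuousWithinAt ξ (Ici 0) 0`, `ξ 0 = x` force `c = q·x`, then MOVING
gives `q·a ≡ c'` and continuity with `a 0 = 0` forces `c' = 0`; if `r = 0` then `Λ = ℤⁿ`, so
`ξ ≡ x` and `a ≡ 0` on `(0, ε)`, contradicting non-triviality. (The `r = 0` step and the frozen-row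
identity are kernel-checked in the refuter's Helpers.lean v2, evidence on stmt-Schanuel-13676.)
[folklore; Ax1971 §3 (reduction to the case "independent modulo constants")] -/
theorem stub_frozenMovingSplit :
    ∀ (n : ℕ) (x : Fin n → ℂ) (a : ℝ → Fin n → ℝ) (ξ : ℝ → Fin n → ℂ) (ε : ℝ),
      0 < ε → a 0 = 0 → ξ 0 = x → ContinuousWithinAt a (Set.Ici 0) 0 →
      ContinuousWithinAt ξ (Set.Ici 0) 0 → AnalyticOnNhd ℝ ξ (Set.Ioo 0 ε) →
      (∃ s ∈ Set.Ioo 0 ε, a s ≠ 0 ∨ ξ s ≠ x) →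
      (∀ q : Fin n → ℤ, (∃ c : ℂ, ∀ s ∈ Set.Ioo 0 ε, ∑ i, (q i : ℂ) * ξ s i = c) →
        (∃ c : ℝ, ∀ s ∈ Set.Ioo 0 ε, ∑ i, (q i : ℝ) * a s i = c)) →
      ∃ (m r : ℕ) (Uu : Matrix (Fin m) (Fin n) ℤ) (Uv : Matrix (Fin r) (Fin n) ℤ) (v : ℝ → Fin r → ℂ),
        m + r = n ∧ 1 ≤ r ∧
        LinearIndependent ℚ (fun k i => (Uu k i : ℚ)) ∧
        (∀ k, ∀ s ∈ Set.Ioo 0 ε, ∑ i, (Uu k i : ℂ) * ξ s i = ∑ i, (Uu k i : ℂ) * x i ∧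
          ∑ i, (Uu k i : ℝ) * a s i = 0) ∧
        (∀ s j, v s j = ∑ i, (Uv j i : ℂ) * ξ s i) ∧
        AnalyticOnNhd ℝ v (Set.Ioo 0 ε) ∧
        (∀ q : Fin r → ℤ, (∃ c : ℂ, ∀ s ∈ Set.Ioo 0 ε, ∑ j, (q j : ℂ) * v s j = c) → q = 0) := by
  sorry

/-- **STUB B — specialisation upper bound over the frozen field** (size L; the DESCENT: Schanuel in
rank `m < n` + `ℚ[P₀] ↠ ℚ[P]` + tower law + algebraicity of the sheet path; margin zero). Under the
first-counterexample hypotheses of the crux (Schanuel in all ranks `< n`, `x` ℚ-independent,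
`trdeg_ℚ ℚ(x, eˣ) < n`), for an analytic deformation `(a, ξ)` on `(0, ε)` whose sheet path is
coordinatewise real-algebraic and whose point `P(s) = (ξ + 2πi a, e^ξ)` lies in the ℚ-locus of
`(x, eˣ)`, and for integer matrices `Uu` (`m` ℚ-independent rows, frozen: `Uu ξ ≡ Uu x`, `Uu a ≡ 0`
on `(0, ε)`) and `Uv` (`r` rows, arbitrary) with `m + r = n`, `1 ≤ r`: every `r + 1` of the `2r`
germs `v_j = (Uv ξ)_j`, `e^{v_j}` satisfy a non-zero polynomial relation over `ℂ` identically on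
`(0, ε)` (equivalently `trdeg_ℂ ℂ(v, e^v) ≤ r` in the fraction field of real-analytic germs).
Proof plan in the module docstring; API: `Algebra.trdeg`, `Algebra.trdeg_add_eq` (tower),
`IntermediateField.adjoin`, `MvPolynomial.aeval` kernels for the specialisation, the identity
principle `AnalyticOnNhd.eqOn_zero_of_preconnected_of_frequently_eq_zero` for the domain of germs,
and a transcendence basis extracted from a generating set for the final "any `r+1` generators are
dependent". [Ax1971 Thm 3 (the counting it feeds); Kirby2010EAEF Prop 7.2 (nearest printed rigidity);
Lang1966 pp. 30–31] -/
theorem stub_specialisationUpperBound :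
    ∀ (n : ℕ), (∀ r < n, ∀ y : Fin r → ℂ, LinearIndependent ℚ y → (r : Cardinal) ≤ Algebra.trdeg ℚ
        ↥(IntermediateField.adjoin ℚ (Set.range y ∪ Set.range (Complex.exp ∘ y)))) →
      ∀ x : Fin n → ℂ, LinearIndependent ℚ x →
      Algebra.trdeg ℚ ↥(IntermediateField.adjoin ℚ (Set.range x ∪ Set.range (Complex.exp ∘ x))) <
        (n : Cardinal) →
      ∀ (a : ℝ → Fin n → ℝ) (ξ : ℝ → Fin n → ℂ) (ε : ℝ), 0 < ε →
      AnalyticOnNhd ℝ a (Set.Ioo 0 ε) → AnalyticOnNhd ℝ ξ (Set.Ioo 0 ε) →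
      (∀ i, ∃ p : MvPolynomial (Fin 2) ℝ, p ≠ 0 ∧ ∀ s ∈ Set.Ioo 0 ε,
        MvPolynomial.eval ![s, a s i] p = 0) →
      (∀ s ∈ Set.Ioo 0 ε, ∀ f : MvPolynomial (Fin n ⊕ Fin n) ℚ,
        MvPolynomial.aeval (Sum.elim x (Complex.exp ∘ x)) f = 0 →
        MvPolynomial.aeval (Sum.elim (fun i => ξ s i + 2 * (Real.pi : ℂ) * Complex.I * ((a s i : ℝ) : ℂ))
          (fun i => Complex.exp (ξ s i))) f = 0) →
      ∀ (m r : ℕ) (Uu : Matrix (Fin m) (Fin n) ℤ) (Uv : Matrix (Fin r) (Fin n) ℤ) (v : ℝ → Fin r → ℂ),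
      m + r = n → 1 ≤ r → LinearIndependent ℚ (fun k i => (Uu k i : ℚ)) →
      (∀ k, ∀ s ∈ Set.Ioo 0 ε, ∑ i, (Uu k i : ℂ) * ξ s i = ∑ i, (Uu k i : ℂ) * x i ∧
        ∑ i, (Uu k i : ℝ) * a s i = 0) →
      (∀ s j, v s j = ∑ i, (Uv j i : ℂ) * ξ s i) →
      ∀ φ : Fin (r + 1) ↪ (Fin r ⊕ Fin r), ∃ P : MvPolynomial (Fin (r + 1)) ℂ, P ≠ 0 ∧
        ∀ s ∈ Set.Ioo 0 ε,
          MvPolynomial.eval (fun k => Sum.elim (v s) (fun j => Complex.exp (v s j)) (φ k)) P = 0 := by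
  sorry

/-- **STUB C — Ax–Schanuel for real-analytic germs in one variable** (size L; Ax 1971 Thm 3 with one
derivation, in the form the line consumes). If `v₁, …, v_r` (`r ≥ 1`) are analytic on `(0, ε)` and
ℚ-linearly independent modulo constants there (no non-zero integer combination is constant), then some
`r + 1` of the `2r` germs `v_j, e^{v_j}` are algebraically independent over `ℂ` on `(0, ε)`: a
polynomial over `ℂ` vanishing identically on them is zero. (`trdeg_ℂ ℂ(v, e^v) ≥ r + rank(∂v)`,
and `rank(∂v) = 1` because an independent-mod-constants `v₁` is not constant; a transcendence basis
of `ℂ(v, e^v)/ℂ` can be chosen among the generators.) Proof plan: instantiate the tree's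
`Literature.NumberTheory.Transcendental.ax_schanuel_holds` (Ax in differential-field form, proved via
Rosenlicht 1976 Prop 4) with `K` = fraction field of the domain of ℂ-valued real-analytic germs on
the connected interval `(0, ε)` (or transport by Taylor expansion at an interior point into
`LaurentSeries ℂ`, as the KZ-periods line `AxSchanuelGerms` does over `ℝ`), `D = d/ds`, constants
`constantSubring D = ℂ` (locally constant ⇒ constant), `z_j = e^{v_j} ≠ 0`, `D z_j = z_j D v_j`,
`IsQLinearIndependentMod` = the hypothesis; then read the `Algebra.trdeg` bound back as an independent
`(r+1)`-subfamily of generators and unfold `AlgebraicIndependent` pointwise (identity principle).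
[Ax1971 Thm 3 & Cor 1; Pila2022 Thm 13.10–13.12 (differential ⇔ analytic form);
Literature.NumberTheory.Transcendental.ax_schanuel_holds] -/
theorem stub_axSchanuelGerms :
    ∀ (r : ℕ) (ε : ℝ) (v : ℝ → Fin r → ℂ), 0 < ε → 1 ≤ r → AnalyticOnNhd ℝ v (Set.Ioo 0 ε) →
      (∀ q : Fin r → ℤ, (∃ c : ℂ, ∀ s ∈ Set.Ioo 0 ε, ∑ j, (q j : ℂ) * v s j = c) → q = 0) →
      ∃ φ : Fin (r + 1) ↪ (Fin r ⊕ Fin r), ∀ P : MvPolynomial (Fin (r + 1)) ℂ,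
        (∀ s ∈ Set.Ioo 0 ε,
          MvPolynomial.eval (fun k => Sum.elim (v s) (fun j => Complex.exp (v s j)) (φ k)) P = 0) →
        P = 0 := by
  sorry

/-! ## Composition: the crux BY NAME from the three stub statements -/

/-- **`MovingDescent` from the three stubs** (pure logic, no `sorry` of its own; axioms
`propext`, `Classical.choice`, `Quot.sound`). The hypotheses are, verbatim, the statements of
`stub_frozenMovingSplit`, `stub_specialisationUpperBound`, `stub_axSchanuelGerms`; the conclusion is
the route decl `Summit.Schanuel.Schanuel.Theses.SheetDescent.MovingDescent`. A splits the deformation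
into frozen and moving blocks (`r ≥ 1`); C produces an algebraically independent `(r+1)`-subfamily
of `(v, e^v)`; B produces a non-zero relation on that subfamily. -/
theorem MovingDescent_of :
    (∀ (n : ℕ) (x : Fin n → ℂ) (a : ℝ → Fin n → ℝ) (ξ : ℝ → Fin n → ℂ) (ε : ℝ),
      0 < ε → a 0 = 0 → ξ 0 = x → ContinuousWithinAt a (Set.Ici 0) 0 →
      ContinuousWithinAt ξ (Set.Ici 0) 0 → AnalyticOnNhd ℝ ξ (Set.Ioo 0 ε) →
      (∃ s ∈ Set.Ioo 0 ε, a s ≠ 0 ∨ ξ s ≠ x) →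
      (∀ q : Fin n → ℤ, (∃ c : ℂ, ∀ s ∈ Set.Ioo 0 ε, ∑ i, (q i : ℂ) * ξ s i = c) →
        (∃ c : ℝ, ∀ s ∈ Set.Ioo 0 ε, ∑ i, (q i : ℝ) * a s i = c)) →
      ∃ (m r : ℕ) (Uu : Matrix (Fin m) (Fin n) ℤ) (Uv : Matrix (Fin r) (Fin n) ℤ) (v : ℝ → Fin r → ℂ),
        m + r = n ∧ 1 ≤ r ∧
        LinearIndependent ℚ (fun k i => (Uu k i : ℚ)) ∧
        (∀ k, ∀ s ∈ Set.Ioo 0 ε, ∑ i, (Uu k i : ℂ) * ξ s i = ∑ i, (Uu k i : ℂ) * x i ∧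
          ∑ i, (Uu k i : ℝ) * a s i = 0) ∧
        (∀ s j, v s j = ∑ i, (Uv j i : ℂ) * ξ s i) ∧
        AnalyticOnNhd ℝ v (Set.Ioo 0 ε) ∧
        (∀ q : Fin r → ℤ, (∃ c : ℂ, ∀ s ∈ Set.Ioo 0 ε, ∑ j, (q j : ℂ) * v s j = c) → q = 0)) →
    (∀ (n : ℕ), (∀ r < n, ∀ y : Fin r → ℂ, LinearIndependent ℚ y → (r : Cardinal) ≤ Algebra.trdeg ℚ
        ↥(IntermediateField.adjoin ℚ (Set.range y ∪ Set.range (Complex.exp ∘ y)))) →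
      ∀ x : Fin n → ℂ, LinearIndependent ℚ x →
      Algebra.trdeg ℚ ↥(IntermediateField.adjoin ℚ (Set.range x ∪ Set.range (Complex.exp ∘ x))) <
        (n : Cardinal) →
      ∀ (a : ℝ → Fin n → ℝ) (ξ : ℝ → Fin n → ℂ) (ε : ℝ), 0 < ε →
      AnalyticOnNhd ℝ a (Set.Ioo 0 ε) → AnalyticOnNhd ℝ ξ (Set.Ioo 0 ε) →
      (∀ i, ∃ p : MvPolynomial (Fin 2) ℝ, p ≠ 0 ∧ ∀ s ∈ Set.Ioo 0 ε,
        MvPolynomial.eval ![s, a s i] p = 0) →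
      (∀ s ∈ Set.Ioo 0 ε, ∀ f : MvPolynomial (Fin n ⊕ Fin n) ℚ,
        MvPolynomial.aeval (Sum.elim x (Complex.exp ∘ x)) f = 0 →
        MvPolynomial.aeval (Sum.elim (fun i => ξ s i + 2 * (Real.pi : ℂ) * Complex.I * ((a s i : ℝ) : ℂ))
          (fun i => Complex.exp (ξ s i))) f = 0) →
      ∀ (m r : ℕ) (Uu : Matrix (Fin m) (Fin n) ℤ) (Uv : Matrix (Fin r) (Fin n) ℤ) (v : ℝ → Fin r → ℂ),
      m + r = n → 1 ≤ r → LinearIndependent ℚ (fun k i => (Uu k i : ℚ)) →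
      (∀ k, ∀ s ∈ Set.Ioo 0 ε, ∑ i, (Uu k i : ℂ) * ξ s i = ∑ i, (Uu k i : ℂ) * x i ∧
        ∑ i, (Uu k i : ℝ) * a s i = 0) →
      (∀ s j, v s j = ∑ i, (Uv j i : ℂ) * ξ s i) →
      ∀ φ : Fin (r + 1) ↪ (Fin r ⊕ Fin r), ∃ P : MvPolynomial (Fin (r + 1)) ℂ, P ≠ 0 ∧
        ∀ s ∈ Set.Ioo 0 ε,
          MvPolynomial.eval (fun k => Sum.elim (v s) (fun j => Complex.exp (v s j)) (φ k)) P = 0) →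
    (∀ (r : ℕ) (ε : ℝ) (v : ℝ → Fin r → ℂ), 0 < ε → 1 ≤ r → AnalyticOnNhd ℝ v (Set.Ioo 0 ε) →
      (∀ q : Fin r → ℤ, (∃ c : ℂ, ∀ s ∈ Set.Ioo 0 ε, ∑ j, (q j : ℂ) * v s j = c) → q = 0) →
      ∃ φ : Fin (r + 1) ↪ (Fin r ⊕ Fin r), ∀ P : MvPolynomial (Fin (r + 1)) ℂ,
        (∀ s ∈ Set.Ioo 0 ε,
          MvPolynomial.eval (fun k => Sum.elim (v s) (fun j => Complex.exp (v s j)) (φ k)) P = 0) →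
        P = 0) →
    MovingDescent := by
  intro hA hB hC n hlow x hx hd hdef
  obtain ⟨a, ξ, ε, ⟨hε, ha0, hξ0, hca, hcξ, hana, hanξ, hsheet, hlocus⟩, hnt, hmov⟩ := hdef
  obtain ⟨m, r, Uu, Uv, v, hmr, hr, hUu, hfrozen, hv, hvan, hq⟩ :=
    hA n x a ξ ε hε ha0 hξ0 hca hcξ hanξ hnt hmov
  obtain ⟨φ, hφ⟩ := hC r ε v hε hr hvan hq
  obtain ⟨P, hP0, hP⟩ :=
    hB n hlow x hx hd a ξ ε hε hana hanξ hsheet hlocus m r Uu Uv v hmr hr hUu hfrozen hv φ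
  exact hP0 (hφ P hP)

/-- Sanity (modulo the stubs' sorries; carries `sorryAx` through them and through them only): the
composition applied to the three stubs proves the crux — the mechanical check that the stub statements
and the composition's hypotheses agree verbatim. -/
theorem movingDescent_via_stubs : MovingDescent :=
  MovingDescent_of stub_frozenMovingSplit stub_specialisationUpperBound stub_axSchanuelGerms

end Summit.Schanuel.Schanuel.Cruxes.MovingDescent.Birth

end
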